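import Literature.MathematicalPhysics.QuantumLattice.HubbardTPPObjectMFloorBoxWords
import Literature.MathematicalPhysics.QuantumLattice.HubbardTPPObjectMCapBoxWordsConst
import HarnessLib

/-!
# Object-M floor words on `(U, t', t'', n)` boxes: `t''`-exact rows at the SMALL-`t''` edge plus the kinematic `t''`-allowance

Topic `MathematicalPhysics/QuantumLattice`, family `hubbard`. Companion of `HubbardTPPObjectMFloorBoxWords`. A cluster floor
of object M that carries the third-neighbour hopping EXACTLY (`HubbardOpenBoxTPPClusterOracle` +
`tiGroundEnergyDensityAt_tpp_ge_of_boxFloors_2x3_oneTable`) is concave in `t''` with a slope that can exceed the kinematic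
Lipschitz constant `16/π²` of `e^M` (`abs_tiGroundEnergyDensityAt_tpp_sub_le_kinematic`, `HubbardTTPrimeTPPKinematicLipschitz`)
when the box's `t''` range is wide. The HYBRID rule below reads the `t''`-exact rows only at the SMALLER-`|t''|` edge `r₁` of the
box (two `t'` corners at the lower `U` edge) and pays the kinematic allowance `(16/π²)·(r₂ − r₁) ≤ 1.6212·(r₂ − r₁)` for the rest:
**`tpp_floor₄_of_edgeRowsLo_kinematic`** (in the `∀ u s r n` shape of `tpp_word_Icc₄_of_forall₄`).

Everything is proved; no named fact; no definition.

## References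

* R. B. Israel, Convexity in the Theory of Lattice Gases (1979), Thm. I.3.4. [cite: Israel1979, Thm. I.3.4]
* R. T. Rockafellar, Convex Analysis (1970), Thm 32.2. [cite: Rockafellar1970, Thm 32.2]
* R. B. Griffiths, 1966, §II (monotonicity in couplings). [cite: Griffiths1966, §II]
-/

noncomputable section

namespace Literature.MathematicalPhysics.QuantumLattice

open Set ThermodynamicLimit

/-- An affine function on an interval is bounded below by its smaller endpoint value. [folklore] -/
private theorem affine_ge_of_endpoints' {A B n₁ n₂ n L : ℝ} (h1 : L ≤ A + B * n₁) (h2 : L ≤ A + B * n₂)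
    (hn₁ : n₁ ≤ n) (hn₂ : n ≤ n₂) : L ≤ A + B * n := by
  rcases le_total 0 B with hB | hB
  · nlinarith
  · nlinarith

/-- **HYBRID FLOOR on a `(U, t', t'', n)` box: two `t''`-exact corner rows at the edge `(U₁, sᵢ, r₁)` plus the kinematic
allowance `1.6212·(r₂ − r₁)`.** If `A + B·ρ ≤ e^M(1, sᵢ, r₁, U₁; ρ)` on `[n₁, n₂]` (`0 < n₁`, `n₂ < 2`, `r₁ ≤ r₂`) for `i = 1, 2` and
`L + 1.6212·(r₂ − r₁)` lies below the four endpoint values, then `L ≤ e^M(1, s, r, u; n)` on the whole box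
`[U₁,U₂]×[s₁,s₂]×[r₁,r₂]×[n₁,n₂]` (segment rule in `t'`, kinematic Lipschitz in `t''`, monotone in `U`).
[cite: Israel1979, Thm. I.3.4] [cite: Rockafellar1970, Thm 32.2] [cite: Griffiths1966, §II] -/
theorem tpp_floor₄_of_edgeRowsLo_kinematic {U₁ U₂ s₁ s₂ r₁ r₂ n₁ n₂ A₁ B₁ A₂ B₂ L : ℝ}
    (hn0 : 0 < n₁) (hn2 : n₂ < 2) (hr : r₁ ≤ r₂)
    (h1 : ∀ ρ ∈ Set.Icc n₁ n₂, A₁ + B₁ * ρ ≤ (hubbardTT'T''FermionInteraction 1 s₁ r₁ U₁).tiGroundEnergyDensityAt 2 ρ)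
    (h2 : ∀ ρ ∈ Set.Icc n₁ n₂, A₂ + B₂ * ρ ≤ (hubbardTT'T''FermionInteraction 1 s₂ r₁ U₁).tiGroundEnergyDensityAt 2 ρ)
    (l1a : L + 1.6212 * (r₂ - r₁) ≤ A₁ + B₁ * n₁) (l1b : L + 1.6212 * (r₂ - r₁) ≤ A₁ + B₁ * n₂)
    (l2a : L + 1.6212 * (r₂ - r₁) ≤ A₂ + B₂ * n₁) (l2b : L + 1.6212 * (r₂ - r₁) ≤ A₂ + B₂ * n₂) :
    ∀ u s r n : ℝ, U₁ ≤ u → u ≤ U₂ → s₁ ≤ s → s ≤ s₂ → r₁ ≤ r → r ≤ r₂ → n₁ ≤ n → n ≤ n₂ →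
      L ≤ (hubbardTT'T''FermionInteraction 1 s r u).tiGroundEnergyDensityAt 2 n := by
  intro u s r n hu₁ _ hs₁ hs₂ hr₁ hr₂ hm₁ hm₂
  have hn0' : 0 < n := lt_of_lt_of_le hn0 hm₁
  have hn2' : n < 2 := lt_of_le_of_lt hm₂ hn2
  have hmem : n ∈ Set.Icc n₁ n₂ := ⟨hm₁, hm₂⟩
  -- the two edge rows at `n`
  have c1 := (affine_ge_of_endpoints' l1a l1b hm₁ hm₂).trans (h1 n hmem)
  have c2 := (affine_ge_of_endpoints' l2a l2b hm₁ hm₂).trans (h2 n hmem)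
  -- segment rule in `t'` at `t'' = r₁` (degenerate rectangle)
  have hseg := tpp_floor_sr_of_corners c1 c1 c2 c2 ⟨hs₁, hs₂⟩ (⟨le_rfl, le_rfl⟩ : r₁ ∈ Set.Icc r₁ r₁)
  -- kinematic transport `r₁ → r`, then monotone in `U`
  have hkin := tiGroundEnergyDensityAt_tpp_sub_kinematic_le 1 s U₁ hn0' hn2' r r₁
  have habs : |r - r₁| = r - r₁ := abs_of_nonneg (by linarith)
  have hallow : 16 / Real.pi ^ 2 * (r₂ - r₁) ≤ 1.6212 * (r₂ - r₁) := kinematicAllowance_le_decimal _ (by linarith)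
  have hπ : 0 ≤ 16 / Real.pi ^ 2 := by positivity
  have hmono := tiGroundEnergyDensityAt_tpp_mono_U 1 s r hn0' hn2' hu₁
  rw [habs] at hkin
  nlinarith [mul_le_mul_of_nonneg_left (show r - r₁ ≤ r₂ - r₁ by linarith) hπ]

end Literature.MathematicalPhysics.QuantumLattice
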